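import Literature.MathematicalPhysics.KineticTheory.HardSphereEuler
import Literature.MathematicalPhysics.KineticTheory.Sweep1
import HarnessLib

/-!
# The compressible Euler limit of hard spheres in a dilute joint limit
(Deng–Hani–Ma 2025, Theorem 3 (1) — a claimed result, recorded as a named fact; D-0012/D-0014)

Topic `Literature/MathematicalPhysics/KineticTheory`. Companion of
`Literature.MathematicalPhysics.KineticTheory.deng_hani_ma_hilbert6` (`HydrodynamicLimits.lean`,
arXiv:2503.01800 **Theorem 2**: hard spheres → incompressible Navier–Stokes–Fourier) and of the
long-time Boltzmann–Grad statements `LongTimeBoltzmannGradLimit` (`Sweep1.lean`, grand-canonical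
vocabulary `gcInitial` / `gcEvolved` / `correlationFn` / `bgActivity`), this file records
arXiv:2503.01800 **Theorem 3, part (1), eq. (1.47)** (PDF p. 11): for the hard-sphere gas on the
torus in the GRAND-CANONICAL ensemble of Definition 1.3 with collision rate `α = δ⁻¹ → ∞` slowly
(rate (1.24)), started from the WELL-PREPARED (Hilbert-expansion-corrected) one-particle datum
(1.43) built on the data of a smooth solution of the ideal-gas compressible Euler system (1.40),
the one-particle correlation function `f₁(t)` is `L¹_{x,v}`-close (`≲ δ`) to the local Maxwellian
`M_{ρ(t),u(t),T(t)}` of that solution, uniformly on its interval of smoothness.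

## The printed statement (arXiv:2503.01800v1, §1.3.2, PDF pp. 10–11; materialised text read)

*Proposition 1.8* ([Caflisch 1980; Guo–Jang–Jiang 2010; Jiang–Luo–Tang]): `d ∈ {2,3}`, the
compressible Euler equations (1.40) on `𝕋ᵈ` with `p = ρT` and energy `ρ(dT + |u|²)/2`; fix a smooth
solution `(ρ, u, T)` on `[0, T_fin]` with data `(ρ₀, u₀, T₀)` and a perturbation `F_R`; the local
Maxwellian `M = ρ (2πT)^{-d/2} e^{-|v-u|²/2T}` (1.41) and the Hilbert expansion `F₀ = M, F₁, …, F₆`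
(1.42); the Boltzmann equation (1.15) with `α = δ⁻¹` and datum
`n₀ = ∑_{j=0}^{6} δʲ Fⱼ(0) + δ³ F_R ≥ 0` (1.43), `sup_{|μ|,|ν| ≤ 2d} ‖M^{-1/2}⟨v⟩^{2d} ∂ˣ_μ∂ᵛ_ν F_R‖_∞ ≤ 1`
(1.44), `∫ n₀ = 1`, has `n(t) = ∑ δʲ Fⱼ(t) + h(t)` with
`‖M^{-1/2} h‖_∞ + ‖M^{-1/2} ∇ₓh‖_∞ ≲ δ^{3/2}` on `[0, T_fin]` (1.45)–(1.46).
*Theorem 3.* "Let `d ∈ {2, 3}`, consider two small parameters `ε, δ > 0`. Also fix a smooth solution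
`(ρ, u, T)` to the Euler equation on an arbitrary time interval `[0, T_fin]`. Assume `T_fin` is
independent of `(ε, δ)`, and otherwise make the same assumptions for these parameters as in
Theorem 2, including (1.24)" — `max(1, δ⁻¹) · max(1, δ⁻¹ T_fin) ≪ (log |log ε|)^{1/2}` — "We also fix
`F_R` as in (1.44). Now, consider the hard sphere system of diameter `ε` particles with random
initial configuration, in the same way as in Theorem 2" — the grand canonical ensemble of
Definition 1.3: law (1.8) with density `(1/N!) W_{0,N} = Z⁻¹ (α ε^{-(d-1)})ᴺ/N! ∏ n₀(zⱼ) 𝟙_{𝒟_N}`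
(1.9)–(1.10), so that `𝔼(N) ε^{d-1} ≈ α` (1.14), here `𝔼(N) ≈ ε^{-(d-1)} δ⁻¹` (1.25) — "with
`α = δ⁻¹` and `n₀(x, v)` defined as in (1.43) which has integral 1. Let `f₁ = f₁(t, x, v)` be the
1-particle correlation function" — (1.13): `f_s(t, z_s) = (α⁻¹ε^{d-1})ˢ ∑ₙ (1/n!) ∫ W_{s+n}(t) dz` —
"Then … (1) Uniformly in `t`" (printed `t ∈ [0, T_kin]`, read `[0, T_fin]`) "we have
`‖f₁(t, x, v) − ρ(t,x)(2πT(t,x))^{-d/2} e^{-|v-u(t,x)|²/2T(t,x)}‖_{L¹_{x,v}} ≲ δ` (1.47)".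
Part (2) ((1.49)–(1.50): convergence in probability of velocity-truncated empirical fields) is NOT
vendored here (see "What is NOT here").

## The formalisation (`d = 3`) and how it relates to the print — every deviation is a WEAKENING

`deng_hani_ma_compressible_euler`: for every classical ideal-gas Euler solution `(ρ, u, θ)` on
`[0, T)` (`IsHardSphereEulerSolution 0 T ρ u θ`: `p = hsPressure 0 ρ θ = ρθ`,
`E = ρ(|u|² + 3θ)/2` — the system (1.40) for `d = 3` — jointly smooth, `ρ, θ > 0`) with
`∫ ρ(0) = 1`, and every closed horizon `[0, T']`, `0 ≤ T' < T` (the printed "smooth solution on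
`[0, T_fin]`, `T_fin` independent of `(ε, δ)`"), THERE IS a family of one-particle data
`n₀ : ℝ → (𝕋³ × ℝ³ → ℝ)`, `δ ↦ n₀^δ` — in print the explicit profile (1.43); here only its printed
consequences are retained: `n₀^δ ≥ 0`, `∫ n₀^δ = 1`, and `‖n₀^δ − ρ₀M_{1,u₀,θ₀}‖_{L¹} ≤ C δ` for
small `δ` (from (1.42)–(1.44): `n₀ − F₀(0) = ∑_{j≥1} δʲFⱼ(0) + δ³F_R` with integrable `Fⱼ(0)`,
`|F_R| ≤ M^{1/2}`) — and a growth function `A`, `A(e) → +∞` as `e → 0⁺` (in print the explicit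
admissible region (1.24); `A(e) = (c (log|log e|)^{1/2} / max(1,T'))^{1/2}` qualifies), such that
along EVERY joint limit `ε_k → 0⁺`, `δ_k → 0⁺` with `δ_k⁻¹ ≤ A(ε_k)`, for all hard-sphere flows
and every `t ∈ [0, T']`, the one-particle correlation function of the time-evolved grand-canonical
state `gcEvolved Φ (gcInitial 𝕋³ ε_k μ_k n₀^{δ_k}) t` with activity
`μ_k = δ_k⁻¹ · bgActivity (Fin 3) ε_k = δ_k⁻¹ ε_k^{-2}` (= (1.9) with `α = δ⁻¹`; `correlationFn μ_k · 1`
= (1.13) with `s = 1`) converges in `L¹(𝕋³ × ℝ³)` to the local Maxwellian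
`localGibbsProfile (ρ t) (u t) (θ t) = ρ(t,x) M_{1,u(t,x),θ(t,x)}(v)` (= (1.41)).
Deviations, all weakenings of the printed Theorem 3 (1): (a) the datum is quantified
existentially with the three listed properties instead of being the explicit (1.43) (the tree has
no Hilbert-expansion vocabulary `L⁻¹`, (1.42)); (b) the rate (1.24) is an abstract growth function;
(c) the bound `≲ δ` uniform in `t` becomes qualitative convergence at each `t ∈ [0, T']` along
admissible sequences; (d) `d = 3` only; (e) "smooth" = the tree's jointly-`C^∞` classical solution
with `ρ, θ > 0`, restricted to `[0, T'] ⊂ [0, T)`. Nothing is strengthened: in particular the data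
are the printed WELL-PREPARED grand-canonical data, NOT the pure local Maxwellian / canonical
ensemble that the routes of `Summits/AtomisticToContinuum/HydrodynamicLimit` use (review of the
first version of this file, p67247: that variant is not covered by Prop. 1.8 — initial layer — nor
by the grand-canonical proof — equivalence of ensembles — and must not carry the paper's name; it
stays route content, e.g. `Theses/ZenoDiameterTransfer.lean` item `DiluteEntropicTwin` (ii)).

## What is NOT here

Part (2) of Theorem 3 (empirical fields (1.49)–(1.50) in probability under the grand-canonical
law): the tree's mode-B vocabulary (`TendstoEmpirical`, `TendstoHydroFieldsAt`) is typed for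
CANONICAL `N`-particle laws, and no probability law on the grand-canonical union space is in the
prelude yet. Part (1)'s truncated moments (1.48) (a corollary of (1.47)). Any canonical /
pure-local-Maxwellian / fixed-density statement (see above and
`Literature.Barriers.AtomisticToContinuum.DiluteRegimeBarrier`).

## References

* Y. Deng, Z. Hani, X. Ma, *Hilbert's sixth problem: derivation of fluid equations via Boltzmann's
  kinetic theory*, arXiv:2503.01800v1 (2025): Def. 1.1–1.4, (1.8)–(1.10), (1.13)–(1.15) (PDF
  pp. 4–6), Thm 1 (1.16) (p. 6), Remark 1.5 (2) (p. 7), Thm 2 with (1.24)–(1.25) (p. 8),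
  Prop. 1.8 with (1.40)–(1.46) (p. 10), Thm 3 with (1.47)–(1.50) (p. 11). Bib key
  `DengHaniMa2024` (claim key, D-0012).
* R. E. Caflisch, *The fluid dynamic limit of the nonlinear Boltzmann equation*, Comm. Pure Appl.
  Math. 33 (1980) 651–666 (bib key `Caflisch1980`): the Hilbert-expansion input of Prop. 1.8.
* H. Spohn, *Large Scale Dynamics of Interacting Particles* (1991), Part I Ch. 3 (bib key
  `Spohn1991`): the vocabulary of `HardSphereEuler.lean`.
-/

noncomputable section

open MeasureTheory Filter Set Topology

namespace Literature.MathematicalPhysics.KineticTheory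

/-- **Deng–Hani–Ma, Theorem 3 (1) (claimed): the one-particle density of a dilute hard-sphere gas
with well-prepared local-equilibrium data follows the local Maxwellian of the ideal-gas compressible
Euler solution on its whole interval of smoothness** — arXiv:2503.01800v1 Thm 3 (1), eq. (1.47),
PDF p. 11, in the weakened form of this file's module docstring (deviations (a)–(e): existential
well-prepared datum with its printed consequences `n₀^δ ≥ 0`, `∫n₀^δ = 1`,
`‖n₀^δ − ρ₀M_{u₀,θ₀}‖_{L¹} ≤ Cδ`; abstract admissible growth `A` of `δ⁻¹` in place of (1.24);
qualitative `L¹` convergence at each `t ∈ [0,T']`; `d = 3`).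
For every classical solution `(ρ, u, θ)` of the ideal-gas compressible Euler system
(`IsHardSphereEulerSolution 0 T ρ u θ`) with `∫ρ(0) = 1` and every `0 ≤ T' < T` there are such a
datum family `n₀` and growth function `A → +∞` at `0⁺` such that for all sequences `ε_k → 0⁺`,
`δ_k → 0⁺` with `δ_k⁻¹ ≤ A(ε_k)`, all hard-sphere flows `Φ k N` of `N` spheres of diameter `ε_k`
on `𝕋³`, and every `t ∈ [0, T']`, the one-particle correlation function (1.13) of the grand-canonical
state (1.9) with activity `δ_k⁻¹ ε_k⁻²` and profile `n₀^{δ_k}`, evolved to time `t`, converges in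
`L¹(𝕋³ × ℝ³)` to `ρ(t,x) M_{1,u(t,x),θ(t,x)}(v)` (`localGibbsProfile (ρ t) (u t) (θ t)`).
[claim: DengHaniMa2024, status: under-review] -/
def deng_hani_ma_compressible_euler : Prop :=
  ∀ (T : ℝ) (ρ θ : ℝ → T3 → ℝ) (u : ℝ → T3 → V3), IsHardSphereEulerSolution 0 T ρ u θ →
    (∫ x, ρ 0 x = 1) → ∀ T' : ℝ, 0 ≤ T' → T' < T →
    ∃ n₀ : ℝ → (T3 × V3 → ℝ),
      (∀ δ : ℝ, 0 < δ → (∀ z, 0 ≤ n₀ δ z) ∧ ∫ z, n₀ δ z = 1) ∧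
      (∃ C δ₀ : ℝ, 0 < δ₀ ∧ ∀ δ : ℝ, 0 < δ → δ ≤ δ₀ →
        ∫ z, |n₀ δ z - localGibbsProfile (ρ 0) (u 0) (θ 0) z| ≤ C * δ) ∧
      ∃ A : ℝ → ℝ, Tendsto A (𝓝[>] 0) atTop ∧
        ∀ ε δ : ℕ → ℝ, (∀ k, 0 < ε k) → Tendsto ε atTop (𝓝 0) →
          (∀ k, 0 < δ k) → Tendsto δ atTop (𝓝 0) → (∀ k, (δ k)⁻¹ ≤ A (ε k)) →
          ∀ Φ : (k N : ℕ) → Literature.Analysis.FluidPDE.HardSphereFlow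
              (Literature.Analysis.FluidPDE.Torus.geometry (Fin 3)) (ε k) N,
            ∀ t ∈ Icc 0 T',
              Tendsto (fun k => eLpNorm
                (Literature.Analysis.FluidPDE.correlationFn ((δ k)⁻¹ * bgActivity (Fin 3) (ε k))
                    (gcEvolved (Φ k)
                      (Literature.Analysis.FluidPDE.gcInitial
                        (Literature.Analysis.FluidPDE.Torus.geometry (Fin 3)) (ε k)
                        ((δ k)⁻¹ * bgActivity (Fin 3) (ε k)) (n₀ (δ k))) t) 1 -
                  fun z => localGibbsProfile (ρ t) (u t) (θ t) (z 0))
                1 volume) atTop (𝓝 0)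

end Literature.MathematicalPhysics.KineticTheory

end
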